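import Literature.NumberTheory.Irrationality.Zudilin2003.ZetaFourAnalysis
import Literature.NumberTheory.Transcendental.BallRivoalLinearForms
import Literature.NumberTheory.Irrationality.CressonFischlerRivoal2008.WellPoisedSymmetry
import HarnessLib

/-!
# Zudilin 2003 (JTNB), §2 Lemma 1: the partial fractions (18)–(20) of `R_n` with the inclusions (19),
# and the linear form (12) `F_n = U_nζ(5) + U_n'ζ(4) + U_n''ζ(3) + U_n'''ζ(2) − V_n`

Topic `Literature/NumberTheory/Irrationality/Zudilin2003`, sub-namespace `ZetaFour`. Source: W. Zudilin, *Well-poised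
hypergeometric service for diophantine problems of zeta values*, J. Théor. Nombres Bordeaux **15** (2003) 593–626
[Zudilin2003WellPoised], §2 Lemma 1 with its proof, eqs. (12)–(22), READ ON THE PAGE (held text
`paper:galaxy-pdf-1593531969313998860`, p0005). Printed: "the numbers
`A_{jk} = (1/(4−j)!) (d/dt)^{4−j}(R_n(t)(t+k)⁴)|_{t=−k}` … satisfy the inclusions (19) `D_n^{4−j}·A_{jk}^{(n)} ∈ ℤ`
for `k = 0, 1, …, n` and `j = 1, 2, 3, 4`. Now, writing down the partial-fraction expansion of the rational function
(10), (20) `R_n(t) = Σ_{j=1}^{4} Σ_{k=0}^{n} A_{jk}^{(n)}/(t+k)^j`, we obtain that the quantity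
`F_n = Σ_{t=1}^{∞} Σ_j Σ_k jA_{jk}/(t+k)^{j+1} = Σ_j j Σ_k A_{jk}(Σ_{l=1}^{∞} − Σ_{l=1}^{k}) l^{−(j+1)}` has the
desired form (12) with (21) `U_n = 4ΣA_{4k}, U_n' = 3ΣA_{3k}, U_n'' = 2ΣA_{2k}, U_n''' = ΣA_{1k}`,
(22) `V_n = Σ_j jΣ_k A_{jk} Σ_{l=1}^{k} l^{−(j+1)}`."

## How it is followed (the tree's Ball–Rivoal brick calculus)

After the shift `t = τ + 1` (poles `t + k ↦ τ + k + 1`, the convention of `BallRivoal.pfEval`),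
`R_n(τ+1) = (−1)ⁿ(2τ+n+2)·F(τ)²·G(τ)²` with Rivoal's bricks `F(τ) = (τ−n+1)_n/(τ+1)_{n+1}` and
`G(τ) = (τ+n+2)_n/(τ+1)_{n+1}` (`BallRivoal.F_eq_brickEval`, `G_eq_brickEval` at `l = 1`: integer residues
`(−1)^{n+m}C(n,m)C(m+n,n)` and `(−1)^mC(n,m)C(2n−m,n)` — these are the integer-valued polynomials (13) and the
residues (16) of the source); `BallRivoal.exists_pf_prod` expands the product of the four bricks with
`d^{3−o}c_{o,p} ∈ ℤ` (the Leibniz-rule mechanism (14)–(17)), the linear factor `(−1)ⁿ(2τ+n+2) = (−1)ⁿ(2(τ+p+1) + (n−2p))`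
is absorbed into the data (`linData`; the would-be constant `2Σ_pc_{0,p}` vanishes by
`CressonFischlerRivoal2008.partialFractions_sum_order_zero`), giving (18)–(20) with (19) (`exists_pf_Rrat`, THE
data `pfR n` by uniqueness `BallRivoal.pf_unique`). The expansion, proved pointwise over `ℚ`, is transferred to the
real function `R n` of `ZetaFourRecursion.lean` by density of `ℚ` and continuity on `t > 0` (`R_eq_pf`); then
`−R_n'(t) = Σ (o+1)c_{o,p}/(t+p)^{o+2}` on `t > 0` and (12), (21), (22) follow by
`BallRivoal.hasSum_one_div_pow_shift` (`lemma1`: `F_n = Σ_{o<4} (o+1)(Σ_p c_{o,p})ζ(o+2) − V_n`,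
`V_n = Σ_{o<4}Σ_p (o+1)c_{o,p}H_p^{(o+2)}`, with `D_n^{3−o}c_{o,p} ∈ ℤ` and `D_n^5V_n ∈ ℤ`).

## Main statements

* `Rrat`, `cast_Rrat`: (10) over `ℚ`; `Rrat_shift_eq`: `R_n(τ+1) = (−1)ⁿ(2τ+n+2)F(τ)²G(τ)²`;
* `exists_pf_Rrat`: data `c` with `Σ_{p≤n}Σ_{o<4} c_{o,p}/(τ+p+1)^{o+1} = R_n(τ+1)` and `BallRivoal.IsInt 4 d c`
  [(18)–(20) with (19)]; `pfR n` THE data, `pfR_isInt`, `pfR_eq_of_eval` (uniqueness);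
* `R_eq_pf`: `R n t = Σ_{p,o} pfR_{o,p}/(t+p)^{o+1}` for real `t > 0`; `deriv_R_eq_pf`;
* `coefU n o := (o+1)Σ_p pfR n o p` ((21): `U_n''' , U_n'', U_n', U_n` for `o = 0,1,2,3`), `coefV n` ((22)),
  **`lemma1`**: `F n = Σ_{o<4} coefU n o · ζ(o+2) − coefV n` [(12)], `isInt_lcmUpto_pow_mul_coefU`
  (`D_n^{3−o}·coefU n o ∈ ℤ`, in particular `U_n ∈ ℤ`, `D_nU_n' ∈ ℤ`), `isInt_lcmUpto_pow_five_mul_coefV`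
  (`D_n⁵V_n ∈ ℤ`) [Lemma 1, integrality clause].

Everything PROVED (0 sorry); no named facts. NOT here: Lemma 4 (each `coefU · o` solves (3)) and the
identification `U_n' = 6u_n`, `V_n = 6v_n` behind the inclusions (6) (`theorem1_inclusions` stays a named fact).
HONEST FRAMING (cell zeta5-irr): bookkeeping for a printed `ζ(4)` construction; nothing about `ζ(5)`; no rung moves.
-/

noncomputable section

open Finset Filter Topology
open scoped Nat

namespace Literature.NumberTheory.Irrationality.Zudilin2003.ZetaFour

open Literature.NumberTheory.Transcendental (zetaValue)
open Literature.NumberTheory.Transcendental.BallRivoal (poch pfEval brickEval IsInt resF resG harm pochPoly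
  eval_pochPoly F_eq_brickEval G_eq_brickEval exists_pf_prod pf_unique pfEval_sub' hasSum_one_div_pow_shift
  isInt_dpow_mul_harm)
open Literature.NumberTheory.Irrationality.CressonFischlerRivoal2008 (partialFractions_sum_order_zero)

/-! ### `R_n` over `ℚ` and the brick factorisation after `t = τ + 1` -/

/-- The rational function (10) with rational arguments and values. [cite: Zudilin2003WellPoised, §2 eq. (10)] -/
def Rrat (n : ℕ) (t : ℚ) : ℚ :=
  (-1) ^ n * (2 * t + n) *
    ((∏ j ∈ range n, (t - (j + 1))) * (∏ j ∈ range n, (t + n + (j + 1))) /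
      (∏ j ∈ range (n + 1), (t + j)) ^ 2) ^ 2

/-- `Rrat` is `R` on rationals. [cite: Zudilin2003WellPoised, §2 eq. (10)] -/
theorem cast_Rrat (n : ℕ) (t : ℚ) : ((Rrat n t : ℚ) : ℝ) = R n t := by
  unfold Rrat R
  push_cast
  rfl

/-- The shifted blocks as Pochhammer symbols: `C_n(τ+1) = (τ+1)_{n+1}`, `A_n(τ+1) = (τ−n+1)_n`,
`B_n(τ+1) = (τ+n+2)_n`. [cite: Zudilin2003WellPoised, §2 eqs. (10), (13), (15)] -/
theorem shift_factors (n : ℕ) (τ : ℚ) :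
    (∏ j ∈ range (n + 1), (τ + 1 + j)) = poch (τ + 1) (n + 1) ∧
    (∏ j ∈ range n, (τ + 1 - (j + 1))) = poch (τ - n * 1 + 1) n ∧
    (∏ j ∈ range n, (τ + 1 + n + (j + 1))) = poch (τ + n * 1 + 2) n := by
  refine ⟨?_, ?_, ?_⟩
  · rw [poch]
  · rw [poch, ← prod_range_reflect]
    refine prod_congr rfl fun j hj => ?_
    have hj' : j < n := mem_range.1 hj
    rw [Nat.cast_sub (by omega : j ≤ n - 1), Nat.cast_sub (by omega : 1 ≤ n)]
    push_cast; ring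
  · rw [poch]; exact prod_congr rfl fun j _ => by ring

/-- `(τ+1)_{n+1} ≠ 0` away from the poles. [folklore] -/
private theorem poch_succ_ne_zero (n : ℕ) (τ : ℚ) (hτ : ∀ m, m ≤ n → τ + m + 1 ≠ 0) :
    poch (τ + 1) (n + 1) ≠ 0 := by
  rw [poch]
  refine prod_ne_zero_iff.2 fun m hm => ?_
  have := hτ m (Nat.lt_succ_iff.1 (mem_range.1 hm))
  intro h; exact this (by linarith)

/-- **`R_n(τ+1) = (−1)ⁿ(2τ+n+2)·F(τ)²·G(τ)²`** with Rivoal's bricks `F = (τ−n+1)_n/(τ+1)_{n+1}`,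
`G = (τ+n+2)_n/(τ+1)_{n+1}` (integer residues `resF n 1`, `resG n 1`), for `τ ∉ {−1,…,−(n+1)}`.
[cite: Zudilin2003WellPoised, §2 eqs. (13), (15), (18)] -/
theorem Rrat_shift_eq (n : ℕ) (τ : ℚ) (hτ : ∀ m, m ≤ n → τ + m + 1 ≠ 0) :
    Rrat n (τ + 1) = (-1) ^ n * (2 * τ + n + 2) *
      (brickEval n (resF n 1) τ ^ 2 * brickEval n (resG n 1) τ ^ 2) := by
  obtain ⟨hC, hA, hB⟩ := shift_factors n τ
  have hCne := poch_succ_ne_zero n τ hτ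
  rw [← F_eq_brickEval n 1 τ hτ, ← G_eq_brickEval n 1 le_rfl τ hτ, Rrat, hC, hA, hB]
  field_simp
  ring

/-- The four bricks `F, F, G, G` as a family. [cite: Zudilin2003WellPoised, §2 eq. (18)] -/
def brickRes (n : ℕ) : ℕ → ℕ → ℤ := fun s => if s < 2 then resF n 1 else resG n 1

/-- `∏_{s<4} B_s = F²G²`. [cite: Zudilin2003WellPoised, §2 eq. (18)] -/
theorem prod_brickRes (n : ℕ) (τ : ℚ) :
    ∏ s ∈ range 4, brickEval n (brickRes n s) τ = brickEval n (resF n 1) τ ^ 2 * brickEval n (resG n 1) τ ^ 2 := by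
  simp [prod_range_succ, brickRes]
  ring

/-! ### Partial fractions of `F²G²` and the linear factor -/

/-- `deg (pochPoly β n) ≤ n`. [folklore] -/
private theorem natDegree_pochPoly_le (β : ℚ) (n : ℕ) : (pochPoly β n).natDegree ≤ n := by
  unfold pochPoly
  refine (Polynomial.natDegree_prod_le _ _).trans ?_
  refine (sum_le_sum (fun (s : ℕ) _ => (Polynomial.natDegree_X_add_C (β + ((s : ℕ) : ℚ))).le)).trans ?_
  simp

/-- Partial fractions of the core `F(τ)²G(τ)²`: data `c` with `d^{3−o}c_{o,p} ∈ ℤ` and vanishing polar part at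
infinity `Σ_p c_{0,p} = 0` (the core is `O(τ⁻⁴)`). [cite: Zudilin2003WellPoised, §2 eqs. (14)–(19)] -/
theorem exists_pf_core (n d : ℕ) (hdiv : ∀ k : ℕ, 1 ≤ k → k ≤ n → (k : ℤ) ∣ d) :
    ∃ c : ℕ → ℕ → ℚ,
      (∀ τ : ℚ, (∀ m, m ≤ n → τ + m + 1 ≠ 0) →
        pfEval n 4 c τ = brickEval n (resF n 1) τ ^ 2 * brickEval n (resG n 1) τ ^ 2) ∧
      IsInt 4 d c ∧ ∑ p ∈ range (n + 1), c 0 p = 0 := by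
  obtain ⟨c, hc, hint, -⟩ := exists_pf_prod n d hdiv (brickRes n) 4 (by norm_num)
  have hc' : ∀ τ : ℚ, (∀ m, m ≤ n → τ + m + 1 ≠ 0) →
      pfEval n 4 c τ = brickEval n (resF n 1) τ ^ 2 * brickEval n (resG n 1) τ ^ 2 := fun τ hτ => by
    rw [hc τ hτ, prod_brickRes]
  refine ⟨c, hc', hint, ?_⟩
  -- `F²G² = Q(τ)/(τ+1)_{n+1}⁴` with `Q = ((τ−n+1)_n)²((τ+n+2)_n)²`, `deg Q ≤ 4n`
  let Q : Polynomial ℚ := pochPoly (1 - n) n ^ 2 * pochPoly (n + 2) n ^ 2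
  have hQdeg : Q.natDegree + 2 ≤ 4 * (n + 1) := by
    have h1 := natDegree_pochPoly_le (1 - (n : ℚ)) n
    have h2 := natDegree_pochPoly_le ((n : ℚ) + 2) n
    have h3 : (pochPoly (1 - (n : ℚ)) n ^ 2).natDegree ≤ 2 * n :=
      (Polynomial.natDegree_pow_le).trans (by omega)
    have h4 : (pochPoly ((n : ℚ) + 2) n ^ 2).natDegree ≤ 2 * n :=
      (Polynomial.natDegree_pow_le).trans (by omega)
    have h5 : Q.natDegree ≤ 2 * n + 2 * n := (Polynomial.natDegree_mul_le).trans (add_le_add h3 h4)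
    omega
  refine partialFractions_sum_order_zero n 4 (by norm_num) Q hQdeg c fun τ hτ => ?_
  have hF := F_eq_brickEval n 1 τ hτ
  have hG := G_eq_brickEval n 1 le_rfl τ hτ
  simp only [Nat.cast_one, mul_one] at hF hG
  rw [hc' τ hτ, ← hF, ← hG]
  have hCne := poch_succ_ne_zero n τ hτ
  simp only [Q, Polynomial.eval_mul, Polynomial.eval_pow, eval_pochPoly]
  rw [show τ + (1 - (n : ℚ)) = τ - n + 1 by ring, show τ + ((n : ℚ) + 2) = τ + n + 2 by ring]
  field_simp

/-- Absorbing the linear factor `(−1)ⁿ(2τ+n+2) = (−1)ⁿ(2(τ+p+1) + (n−2p))` into partial-fraction data: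
`c'_{o,p} = (−1)ⁿ((n−2p)c_{o,p} + 2c_{o+1,p})`. [cite: Zudilin2003WellPoised, §2 eq. (18)] -/
def linData (n : ℕ) (c : ℕ → ℕ → ℚ) : ℕ → ℕ → ℚ := fun o p =>
  (-1) ^ n * (((n : ℚ) - 2 * p) * c o p + 2 * if o < 3 then c (o + 1) p else 0)

/-- `Σ_{o<4} c'_{o,p}/(τ+p+1)^{o+1} = (−1)ⁿ(2τ+n+2)Σ_{o<4} c_{o,p}/(τ+p+1)^{o+1} − 2(−1)ⁿc_{0,p}` (one pole).
[cite: Zudilin2003WellPoised, §2 eq. (18)] -/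
private theorem linData_pole (n : ℕ) (c : ℕ → ℕ → ℚ) (τ : ℚ) (p : ℕ) (hτ : τ + p + 1 ≠ 0) :
    ∑ o ∈ range 4, linData n c o p / (τ + p + 1) ^ (o + 1) =
      (-1) ^ n * (2 * τ + n + 2) * ∑ o ∈ range 4, c o p / (τ + p + 1) ^ (o + 1) - 2 * (-1) ^ n * c 0 p := by
  simp only [sum_range_succ, sum_range_zero, linData]
  norm_num
  field_simp
  ring

/-- **The data of `R_n(τ+1)`**: `pfEval (linData c) = (−1)ⁿ(2τ+n+2)·pfEval c` when `Σ_p c_{0,p} = 0`.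
[cite: Zudilin2003WellPoised, §2 eqs. (18), (20)] -/
theorem pfEval_linData (n : ℕ) (c : ℕ → ℕ → ℚ) (hz : ∑ p ∈ range (n + 1), c 0 p = 0) (τ : ℚ)
    (hτ : ∀ m, m ≤ n → τ + m + 1 ≠ 0) :
    pfEval n 4 (linData n c) τ = (-1) ^ n * (2 * τ + n + 2) * pfEval n 4 c τ := by
  unfold pfEval
  rw [sum_congr rfl fun p hp => linData_pole n c τ p (hτ p (Nat.lt_succ_iff.1 (mem_range.1 hp))),
    sum_sub_distrib, mul_sum, ← mul_sum, ← mul_sum, hz, mul_zero, sub_zero]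

/-- The inclusions survive the linear factor: `d^{3−o}c'_{o,p} ∈ ℤ`. [cite: Zudilin2003WellPoised, §2 eq. (19)] -/
theorem isInt_linData (n d : ℕ) (c : ℕ → ℕ → ℚ) (hint : IsInt 4 d c) : IsInt 4 d (linData n c) := by
  intro o p
  obtain ⟨z1, hz1⟩ := hint o p
  by_cases ho : o < 3
  · obtain ⟨z2, hz2⟩ := hint (o + 1) p
    refine ⟨(-1) ^ n * (((n : ℤ) - 2 * p) * z1 + 2 * d * z2), ?_⟩
    simp only [linData, if_pos ho]
    have e : (4 : ℕ) - 1 - o = (4 - 1 - (o + 1)) + 1 := by omega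
    push_cast
    rw [← hz1, ← hz2, e, pow_succ]
    ring
  · refine ⟨(-1) ^ n * (((n : ℤ) - 2 * p) * z1), ?_⟩
    simp only [linData, if_neg ho]
    push_cast
    rw [← hz1]
    ring

/-- **Lemma 1, (18)–(20) with (19).** For every common multiple `d` of `1, …, n` there are data `c`
(`c_{o,p} = A_{o+1,p}^{(n)}`) with `R_n(τ+1) = Σ_{p≤n}Σ_{o<4} c_{o,p}/(τ+p+1)^{o+1}` away from the poles and
`d^{3−o}c_{o,p} ∈ ℤ` (so `D_n^{4−j}A_{jk} ∈ ℤ`). [cite: Zudilin2003WellPoised, §2 Lemma 1, eqs. (18)–(20)] -/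
theorem exists_pf_Rrat (n d : ℕ) (hdiv : ∀ k : ℕ, 1 ≤ k → k ≤ n → (k : ℤ) ∣ d) :
    ∃ c : ℕ → ℕ → ℚ,
      (∀ τ : ℚ, (∀ m, m ≤ n → τ + m + 1 ≠ 0) → pfEval n 4 c τ = Rrat n (τ + 1)) ∧ IsInt 4 d c := by
  obtain ⟨c, hc, hint, hz⟩ := exists_pf_core n d hdiv
  refine ⟨linData n c, fun τ hτ => ?_, isInt_linData n d c hint⟩
  rw [pfEval_linData n c hz τ hτ, hc τ hτ, Rrat_shift_eq n τ hτ]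

/-- `j ∣ D_n` for `1 ≤ j ≤ n`. [folklore] -/
private theorem natCast_dvd_lcmUpto_int {j n : ℕ} (h1 : 1 ≤ j) (h2 : j ≤ n) :
    (j : ℤ) ∣ (Nat.lcmUpto n : ℕ) := by
  have : j ∈ Icc 1 n := mem_Icc.2 ⟨h1, h2⟩
  have h := Finset.dvd_lcm (f := id) this
  have h' : j ∣ Nat.lcmUpto n := by simpa [Nat.lcmUpto] using h
  exact_mod_cast h'

/-- THE partial-fraction data `c_{o,p} = A_{o+1,p}^{(n)}` of (20) (chosen with `d = D_n`).
[cite: Zudilin2003WellPoised, §2 eq. (20)] -/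
def pfR (n : ℕ) : ℕ → ℕ → ℚ :=
  (exists_pf_Rrat n (Nat.lcmUpto n) fun _ h1 h2 => natCast_dvd_lcmUpto_int h1 h2).choose

/-- `pfR n` expands `R_n(τ+1)`. [cite: Zudilin2003WellPoised, §2 eq. (20)] -/
theorem pfR_spec (n : ℕ) (τ : ℚ) (hτ : ∀ m, m ≤ n → τ + m + 1 ≠ 0) : pfEval n 4 (pfR n) τ = Rrat n (τ + 1) :=
  (exists_pf_Rrat n (Nat.lcmUpto n) fun _ h1 h2 => natCast_dvd_lcmUpto_int h1 h2).choose_spec.1 τ hτ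

/-- **(19)**: `D_n^{3−o}·pfR n o p ∈ ℤ`, i.e. `D_n^{4−j}A_{jk}^{(n)} ∈ ℤ`. [cite: Zudilin2003WellPoised, §2 eq. (19)] -/
theorem pfR_isInt (n : ℕ) : IsInt 4 (Nat.lcmUpto n) (pfR n) :=
  (exists_pf_Rrat n (Nat.lcmUpto n) fun _ h1 h2 => natCast_dvd_lcmUpto_int h1 h2).choose_spec.2

/-- `pfR n` at natural arguments: `pfEval n 4 (pfR n) k = R_n(k+1)`. [cite: Zudilin2003WellPoised, §2 eq. (20)] -/
theorem pfR_spec_nat (n k : ℕ) : pfEval n 4 (pfR n) (k : ℚ) = Rrat n ((k : ℚ) + 1) :=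
  pfR_spec n k fun m _ => by positivity

/-- **Uniqueness of (20)**: any data expanding `R_n(τ+1)` at all naturals agree with `pfR n` on the support.
[cite: Zudilin2003WellPoised, §2 eq. (20)] -/
theorem pfR_eq_of_eval (n : ℕ) (c : ℕ → ℕ → ℚ) (hc : ∀ k : ℕ, pfEval n 4 c (k : ℚ) = Rrat n ((k : ℚ) + 1))
    (o p : ℕ) (ho : o < 4) (hp : p ≤ n) : c o p = pfR n o p := by
  have h := pf_unique n 4 (fun o p => c o p - pfR n o p) 0 (fun k _ => by
    rw [pfEval_sub', hc k, pfR_spec_nat n k, sub_self]) o p ho hp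
  linarith

/-- (20) at the original argument over `ℚ`: `R_n(t) = Σ_{p≤n}Σ_{o<4} c_{o,p}/(t+p)^{o+1}`, `t ∉ {0,−1,…,−n}`.
[cite: Zudilin2003WellPoised, §2 eq. (20)] -/
theorem Rrat_eq_pf (n : ℕ) (t : ℚ) (ht : ∀ k, k ≤ n → t + k ≠ 0) :
    Rrat n t = ∑ p ∈ range (n + 1), ∑ o ∈ range 4, pfR n o p / (t + p) ^ (o + 1) := by
  have hτ : ∀ m, m ≤ n → (t - 1) + m + 1 ≠ 0 := fun m hm h => ht m hm (by linarith)
  have h := pfR_spec n (t - 1) hτ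
  rw [sub_add_cancel] at h
  rw [← h, pfEval]
  refine sum_congr rfl fun p _ => sum_congr rfl fun o _ => ?_
  congr 2; ring

/-! ### Transfer to the real function `R n` (density of `ℚ`, continuity on `t > 0`) -/

/-- The real partial-fraction sum of (20). [cite: Zudilin2003WellPoised, §2 eq. (20)] -/
def pfSum (n : ℕ) (t : ℝ) : ℝ := ∑ p ∈ range (n + 1), ∑ o ∈ range 4, (pfR n o p : ℝ) / (t + p) ^ (o + 1)

/-- (20) at positive rationals, over `ℝ`. [cite: Zudilin2003WellPoised, §2 eq. (20)] -/
theorem R_ratCast_eq_pfSum (n : ℕ) (q : ℚ) (hq : 0 < q) : R n (q : ℝ) = pfSum n (q : ℝ) := by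
  have h := Rrat_eq_pf n q fun k _ => by positivity
  rw [← cast_Rrat, h, pfSum]
  push_cast
  rfl

/-- `d/dx (c/(x+a)^{k+1}) = −(k+1)c/(x+a)^{k+2}`. [folklore] -/
private theorem hasDerivAt_const_div_pow (a c : ℝ) (k : ℕ) {t : ℝ} (h : t + a ≠ 0) :
    HasDerivAt (fun x : ℝ => c / (x + a) ^ (k + 1)) (-(((k : ℝ) + 1) * c / (t + a) ^ (k + 2))) t := by
  have h1 := ((((hasDerivAt_id t).add_const a).pow (k + 1)).inv (pow_ne_zero _ h)).const_mul c
  have e : (fun x : ℝ => c / (x + a) ^ (k + 1)) = fun x => c * ((x + a) ^ (k + 1))⁻¹ := by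
    funext x; rw [div_eq_mul_inv]
  rw [e]
  refine h1.congr_deriv ?_
  simp only [Pi.pow_apply, id, Nat.add_sub_cancel, Nat.cast_add, Nat.cast_one, mul_one]
  field_simp
  ring

/-- The termwise derivative of (20): `pfSum' = −Σ (o+1)c_{o,p}/(t+p)^{o+2}` at `t > 0`.
[cite: Zudilin2003WellPoised, §2 (display after (20))] -/
def pfSumD (n : ℕ) (t : ℝ) : ℝ :=
  ∑ p ∈ range (n + 1), ∑ o ∈ range 4, -(((o : ℝ) + 1) * (pfR n o p : ℝ) / (t + p) ^ (o + 2))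

/-- `pfSum n` has derivative `pfSumD n t` at `t > 0`. [cite: Zudilin2003WellPoised, §2 (display after (20))] -/
theorem hasDerivAt_pfSum (n : ℕ) {t : ℝ} (ht : 0 < t) : HasDerivAt (pfSum n) (pfSumD n t) t := by
  unfold pfSum pfSumD
  refine HasDerivAt.fun_sum fun p _ => HasDerivAt.fun_sum fun o _ => ?_
  exact hasDerivAt_const_div_pow (p : ℝ) (pfR n o p : ℝ) o (by positivity)

/-- **(20) for the real function**: `R n t = Σ_{p≤n}Σ_{o<4} c_{o,p}/(t+p)^{o+1}` for every real `t > 0`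
(both sides are continuous on `t > 0` and agree on the dense set of positive rationals).
[cite: Zudilin2003WellPoised, §2 eq. (20)] -/
theorem R_eq_pfSum (n : ℕ) {t : ℝ} (ht : 0 < t) : R n t = pfSum n t := by
  -- the filter of rational points near `t`
  have hdense : DenseRange (fun q : ℚ => (q : ℝ)) := Rat.denseRange_cast
  have hbot : (𝓝[Set.range (fun q : ℚ => (q : ℝ))] t).NeBot := hdense.nhdsWithin_neBot t
  have hR : ContinuousAt (R n) t := (hasDerivAt_R n ht).continuousAt
  have hP : ContinuousAt (pfSum n) t := (hasDerivAt_pfSum n ht).continuousAt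
  have h1 : Tendsto (R n) (𝓝[Set.range (fun q : ℚ => (q : ℝ))] t) (𝓝 (R n t)) := hR.tendsto.mono_left inf_le_left
  have h2 : Tendsto (pfSum n) (𝓝[Set.range (fun q : ℚ => (q : ℝ))] t) (𝓝 (pfSum n t)) :=
    hP.tendsto.mono_left inf_le_left
  have heq : R n =ᶠ[𝓝[Set.range (fun q : ℚ => (q : ℝ))] t] pfSum n := by
    have hpos : ∀ᶠ x in 𝓝[Set.range (fun q : ℚ => (q : ℝ))] t, 0 < x :=
      mem_nhdsWithin_of_mem_nhds (Ioi_mem_nhds ht)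
    have hmem : ∀ᶠ x in 𝓝[Set.range (fun q : ℚ => (q : ℝ))] t, x ∈ Set.range (fun q : ℚ => (q : ℝ)) :=
      self_mem_nhdsWithin
    filter_upwards [hpos, hmem] with x hx hxm
    obtain ⟨q, rfl⟩ := hxm
    have hq : (0 : ℝ) < (q : ℝ) := hx
    exact R_ratCast_eq_pfSum n q (by exact_mod_cast hq)
  exact tendsto_nhds_unique h1 (h2.congr' heq.symm)

/-! ### The derivative of the expansion and Lemma 1 (12), (21), (22) -/

/-- **`−R_n'(t) = Σ_{p,o} (o+1)c_{o,p}/(t+p)^{o+2}`** for real `t > 0`.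
[cite: Zudilin2003WellPoised, §2 (display after (20))] -/
theorem deriv_R_eq_pf (n : ℕ) {t : ℝ} (ht : 0 < t) :
    deriv (R n) t = ∑ p ∈ range (n + 1), ∑ o ∈ range 4, -(((o : ℝ) + 1) * (pfR n o p : ℝ) / (t + p) ^ (o + 2)) := by
  have h : HasDerivAt (R n) (pfSumD n t) t := by
    refine (hasDerivAt_pfSum n ht).congr_of_eventuallyEq ?_
    filter_upwards [Ioi_mem_nhds ht] with x hx
    exact R_eq_pfSum n hx
  rw [h.deriv, pfSumD]

/-- **(21)**: `coefU n o = (o+1)·Σ_p c_{o,p}` — `U_n''' , U_n'', U_n', U_n` for `o = 0, 1, 2, 3`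
(`U_n' = 3Σ_kA_{3k}` etc.). [cite: Zudilin2003WellPoised, §2 eq. (21)] -/
def coefU (n o : ℕ) : ℚ := ((o : ℚ) + 1) * ∑ p ∈ range (n + 1), pfR n o p

/-- **(22)**: `V_n = Σ_j jΣ_k A_{jk} Σ_{l=1}^{k} l^{−(j+1)} = Σ_{o<4}Σ_{p≤n} (o+1)c_{o,p}H_p^{(o+2)}`.
[cite: Zudilin2003WellPoised, §2 eq. (22)] -/
def coefV (n : ℕ) : ℚ := ∑ o ∈ range 4, ∑ p ∈ range (n + 1), ((o : ℚ) + 1) * pfR n o p * harm (o + 2) p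

/-- **Lemma 1, (12)** (Zudilin 2003): `F_n = U_nζ(5) + U_n'ζ(4) + U_n''ζ(3) + U_n'''ζ(2) − V_n`, i.e.
`F n = Σ_{o<4} coefU n o · ζ(o+2) − coefV n`. [cite: Zudilin2003WellPoised, §2 Lemma 1, eq. (12)] -/
theorem lemma1 (n : ℕ) : F n = ∑ o ∈ range 4, (coefU n o : ℝ) * zetaValue (o + 2) - (coefV n : ℝ) := by
  -- the series of `−R_n'(k+1)` summed termwise
  have hterm : ∀ p ∈ range (n + 1), ∀ o ∈ range 4,
      HasSum (fun k : ℕ => ((o : ℝ) + 1) * (pfR n o p : ℝ) / ((k : ℝ) + 1 + p) ^ (o + 2))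
        (((o : ℝ) + 1) * (pfR n o p : ℝ) * (zetaValue (o + 2) - (harm (o + 2) p : ℝ))) := by
    intro p _ o _
    have h := (hasSum_one_div_pow_shift (o + 2) p (by omega)).mul_left (((o : ℝ) + 1) * (pfR n o p : ℝ))
    refine h.congr_fun fun k => ?_
    rw [show (k : ℝ) + 1 + p = k + p + 1 by ring]
    ring
  have hsum : HasSum (fun k : ℕ => ∑ p ∈ range (n + 1), ∑ o ∈ range 4,
      ((o : ℝ) + 1) * (pfR n o p : ℝ) / ((k : ℝ) + 1 + p) ^ (o + 2))
      (∑ p ∈ range (n + 1), ∑ o ∈ range 4,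
        ((o : ℝ) + 1) * (pfR n o p : ℝ) * (zetaValue (o + 2) - (harm (o + 2) p : ℝ))) :=
    hasSum_sum fun p hp => hasSum_sum fun o ho => hterm p hp o ho
  have hF : HasSum (fun k : ℕ => -deriv (R n) ((k : ℝ) + 1)) (∑ p ∈ range (n + 1), ∑ o ∈ range 4,
        ((o : ℝ) + 1) * (pfR n o p : ℝ) * (zetaValue (o + 2) - (harm (o + 2) p : ℝ))) := by
    refine hsum.congr_fun fun k => ?_
    rw [deriv_R_eq_pf n (by positivity : (0 : ℝ) < k + 1)]
    simp only [sum_neg_distrib, neg_neg]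
  rw [(hasSum_F n).unique hF]
  simp only [coefU, coefV]
  push_cast
  rw [sum_comm]
  simp only [mul_sub, sum_sub_distrib]
  congr 1
  refine sum_congr rfl fun o _ => ?_
  rw [mul_sum, sum_mul]

/-! ### The integrality clause of Lemma 1 -/

/-- **`D_n^{3−o}·coefU n o ∈ ℤ`** (`U_n ∈ ℤ`, `D_nU_n' ∈ ℤ`, `D_n²U_n'' ∈ ℤ`, `D_n³U_n''' ∈ ℤ`).
[cite: Zudilin2003WellPoised, §2 Lemma 1 ("U_n, D_nU_n', D_n²U_n'', D_n³U_n''' ∈ ℤ")] -/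
theorem isInt_lcmUpto_pow_mul_coefU (n o : ℕ) :
    ∃ z : ℤ, (Nat.lcmUpto n : ℚ) ^ (3 - o) * coefU n o = z := by
  have hp : ∀ p ∈ range (n + 1), ∃ z : ℤ, (Nat.lcmUpto n : ℚ) ^ (3 - o) * pfR n o p = z := by
    intro p _
    obtain ⟨w, hw⟩ := pfR_isInt n o p
    exact ⟨w, by rw [← hw]⟩
  choose z hz using hp
  refine ⟨((o : ℤ) + 1) * ∑ p ∈ (range (n + 1)).attach, z p.1 p.2, ?_⟩
  rw [coefU, mul_left_comm, mul_sum, ← sum_attach]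
  push_cast
  congr 1
  exact sum_congr rfl fun p _ => hz p.1 p.2

/-- **`D_n⁵·V_n ∈ ℤ`** (from `D_n^{3−o}c_{o,p} ∈ ℤ` and `D_n^{o+2}H_p^{(o+2)} ∈ ℤ`, `p ≤ n`).
[cite: Zudilin2003WellPoised, §2 Lemma 1 ("D_n⁵V_n ∈ ℤ"), eq. (22)] -/
theorem isInt_lcmUpto_pow_five_mul_coefV (n : ℕ) : ∃ z : ℤ, (Nat.lcmUpto n : ℚ) ^ 5 * coefV n = z := by
  have hterm : ∀ o ∈ range 4, ∀ p ∈ range (n + 1),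
      ∃ z : ℤ, (Nat.lcmUpto n : ℚ) ^ 5 * (((o : ℚ) + 1) * pfR n o p * harm (o + 2) p) = z := by
    intro o ho p hp
    have ho' : o < 4 := mem_range.1 ho
    have hp' : p ≤ n := Nat.lt_succ_iff.1 (mem_range.1 hp)
    obtain ⟨w, hw⟩ := pfR_isInt n o p
    obtain ⟨y, hy⟩ := isInt_dpow_mul_harm n (Nat.lcmUpto n) (fun _ h1 h2 => natCast_dvd_lcmUpto_int h1 h2)
      (o + 2) p hp'
    refine ⟨((o : ℤ) + 1) * w * y, ?_⟩
    have e : (5 : ℕ) = (4 - 1 - o) + (o + 2) := by omega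
    rw [e, pow_add]
    push_cast
    rw [← hw, ← hy]
    ring
  have hterm' : ∀ q ∈ range 4 ×ˢ range (n + 1),
      ∃ z : ℤ, (Nat.lcmUpto n : ℚ) ^ 5 * (((q.1 : ℚ) + 1) * pfR n q.1 q.2 * harm (q.1 + 2) q.2) = z :=
    fun q hq => hterm q.1 (mem_product.1 hq).1 q.2 (mem_product.1 hq).2
  choose z hz using hterm'
  refine ⟨∑ q ∈ (range 4 ×ˢ range (n + 1)).attach, z q.1 q.2, ?_⟩
  rw [coefV, ← sum_product', mul_sum, ← sum_attach]
  push_cast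
  exact sum_congr rfl fun q _ => hz q.1 q.2

end Literature.NumberTheory.Irrationality.Zudilin2003.ZetaFour

end
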